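import Summits.QuantumFields.YangMills.Theorems.BalabanUVNodesN27AtSpineReadingOfRecord13CoPHVCut
import Summits.QuantumFields.YangMills.Theorems.BalabanUVNodesN19CoreEdgeFSCComposer
import Summits.QuantumFields.YangMills.Theorems.BalabanUVNodesN21KeyedShellWeightShellZero
import Literature.MathematicalPhysics.QuantumFieldTheory.Balaban1983to89.Node00.Record12MeasurabilityAbsolute

/-!
# ★ K3⁷ v4 RE-KEY (plan g82 YMPLAN-G82-K3V4-REGISTERED 17c74fac127b5f61, 02:48Z 2026-08-28, pub-ymgap INBOX l.27703) OF THIS LINEAGE's PINNED COMPOSER STOREY: B5 at the per-tuple-cut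
# physical-volume spine reading of record `fun F θ hP g₀ os ↦ crOfRecord₁₃VAt K₀ (jc F θ hP g₀ os) sh F θ hP g₀ os` (= v3∕v4 `PinnedAtLive jc sh cr` at `K₀ = 0`, UNCHANGED in v4) with the
# RATES and the N19′ EDGE read in v4's **FULL-PREFIX ∕ FSC KEY** — `… → (B) EndStatementBPrinted D.C → EndpointExistence D.C.toB12 → ForSmallCouplings D (fun g₀ ↦ ∀ os, …)` (v4 (a):
# `KeyedRatesHolderD4` ∕ `KeyedCoreEdgeHolderD4` texts = dag-n19-w3's `keyedGuarded₁₃CoPH_of_keyedFacesP_fsc` shapes, p595910) — N20 ∕ N21 in keyed witness form (v4: UNCHANGED keys), N27x a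
# THEOREM (UC §0), (H-U) ∕ `0 ≤ ζ` THEOREMS.  The v3-keyed storey UC `…N27AtSpineReadingOfRecord13CoPHVCut` (p595448, ∀-`g₀` rates — «stronger than the crux reads», plan) STANDS; this is
# its ONE re-key per the plan's RE-KEY RECIPE (an ∀-`g₀` face feeds these binders by `fun F θ hP hG hθ _ _ ↦ ForSmallCouplings.of_forall fun g₀ os ↦ …`)
# (cell `pub-ymgap`, HUMAN RULING D-0062 Track A, R134 seat `pub-ymgap-dag-n27-c` (N27 B5 composite, s2) gen 12, HOME trigger (t3′) «plan K3⁷ v4»; K3⁷ `SpineGivenEndpointR13SepCoPH` =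
# stmt-QuantumFields-20544, `--kind proof --supports 20544 --as helper`; COUNT-NEUTRAL; THEOREMS ONLY, 0 `def`, 0 `sorry`; `N`-generic, `K₀`-generic, regime-generic, NO Theses import — the item
# face is leaf `…N27SpineGivenEndpointR13SepCoPHSpineReadingOfRecordVCutFSC`)

WHAT IS KERNEL-CHECKED ([bookkeeping]; ONE application of dag-n19-w3's FSC composer at the reading, through XXXVIᶜᵒᵖᴴ `spine_rec13CCoPHOn_iff_forall_guarded`, with dag-n20-d's transfers
`relWeightBound_∕shellWeightBound_∕core_crOfRecord₁₃VAt` per tuple at `jcut := jc F θ hP g₀ os`, the N19′ witness transported INSIDE `ForSmallCouplings` by `ForSmallCouplings.mono`).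
* §1 ★★ `spine_rec13CCoPHOn_at_crOfRecord₁₃VAt_cut_of_keyedFacesP_fsc` — any regime `Rg`, `hsel` per tuple: N20 ∕ N21 keyed witnesses (∀ `g₀`), the RATES `P` at `rr` and the N19′ edge in
  the FSC full-prefix key, the law `hζm` ⇒ `Spine` at `IsRecordOfRecord₁₃CCoPHOn F N Rg`.
* §2 ★★ `spine_rec13CCoPHOn_live_at_crOfRecord₁₃VAt_cut_of_keyedFacesP_fsc` — the same ON THE LIVE LINE of a regime `G` (`hsel` read off the regime).  At `N = 2`, `G :=` guard,
  `P := PHolderD4 β`, `rr := rrOfRecord 𝔯 ksel`, `K₀ = 0` the binders `hrates` ∕ `h19` ARE v4's `KeyedRatesHolderD4 β rr` ∕ the keyed-witness form of `KeyedCoreEdgeHolderD4 β cr rr` on the live line.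
Consumed BY NAME: dag-n19-w3 `keyedGuarded₁₃CoPH_of_keyedFacesP_fsc` (p595910); UC §0 `keyedExtraction_crOfRecord₁₃VAt_cut` (p595448); dag-n20-d p590105 transfers;
`SpineCanonicalWeights.core_nonneg_of_shellWeightBound`; `ForSmallCouplings.mono` (T4ContinuumYM4Torus); node00-def-K0c `localBgMeasurable`; dag-n20-w2 `zeta_nonneg_of_provisos₁₃CoPH`.

HONEST FRAMING.  COMPOSITE-node bookkeeping BY NAME; no estimate; every displayed antecedent (v4-keyed rates and N19′ edge, keyed N20 ∕ N21 witnesses, `hζm`, the selector pin) is a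
HYPOTHESIS inhabited for no family today (K0⁷ OPEN); `jc sh` FREE; nothing of Bałaban's asserted or instantiated; N19 ∕ N20 ∕ N21 ∕ N27 NOT discharged; K3⁷ NOT claimed; skeleton v4 is the
plan's, untouched (its composition = dag-n19-w3's composer at a generic `cr`; this storey is the instance AT THE PIN); counts UNMOVED (typed 28∕28 · discharged 5∕27, A 5∕28); one finite
four-torus programme at fixed `ε` — NOT ℝ⁴, NOT infinite volume, NOT OS, NOT a mass gap, NOT Clay.  No decl below carries a cite tag.
-/

set_option autoImplicit false

namespace Summit.QuantumFields.YangMills.Theorems.BalabanUVNodesN27SpineRecord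

open scoped BigOperators
open Literature.MathematicalPhysics.QuantumFieldTheory.Balaban1983to89
open Literature.MathematicalPhysics.QuantumFieldTheory.Balaban1983to89.T4Continuum
open Literature.MathematicalPhysics.QuantumFieldTheory.Balaban1983to89.Node00
open T4WeightBudget (RelWeightBound)
open T4IndicatorShell (ShellWeightBound)
open T4ContinuumYM4Torus (ForSmallCouplings)
open Summit.QuantumFields.BalabanUV.T4Continuum.Spine
open YMDAG.UVSplit
open Summit.QuantumFields.YangMills.BalabanUVNodes.SpineCanonicalWeights (core_nonneg_of_shellWeightBound)
open Summit.QuantumFields.YangMills.BalabanUVNodes.N19TargetClassWeightsE1Keyed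
open Summit.QuantumFields.YangMills.BalabanUVNodes.N19CoreEdgeFSCComposer (keyedGuarded₁₃CoPH_of_keyedFacesP_fsc)
open Summit.QuantumFields.YangMills.BalabanUVNodes.N21KeyedShellWeightShellZero (zeta_nonneg_of_provisos₁₃CoPH)

variable {N : ℕ} [NeZero N] (K₀ : ℕ)
  (jc : (F : T4Family) → (θ : Stage13HParams F N) → θ.Provisos₁₃CoPH F N → (ℕ → ℝ) → List (ULoop F) → ℕ → ℕ)
  (sh : ShellSplit₁₃CoPH N K₀) (Rg : (F : T4Family) → Stage13HParams F N → Prop)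
  (rr : (F : T4Family) → (θ : Stage13HParams F N) → θ.Provisos₁₃CoPH F N → (ℕ → ℝ) → List (ULoop F) → RateCarriers N)
  (P : ∀ {F : T4Family}, Datum F N → RateCarriers N → Prop)

/-! ## §1 Any regime, `hsel` per tuple — rates and N19′ edge in v4's FSC full-prefix key -/

/-- ★★ **N27 = B5 AT THE REGIME RECORD CLASS, SPINE READING PINNED AT THE PER-TUPLE-CUT V READING, RATES AND N19′ EDGE IN K3⁷ v4's FSC FULL-PREFIX KEY** (dag-n19-w3
`keyedGuarded₁₃CoPH_of_keyedFacesP_fsc` at `cr := fun F θ hP g₀ os ↦ crOfRecord₁₃VAt K₀ (jc F θ hP g₀ os) sh F θ hP g₀ os`, `G := Rg F`): keyed N20 ∕ N21 witnesses (∀ `g₀`; v4's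
`KeyedRelWeight`∕`KeyedShellWeight` keys are unchanged), `hrates` ∕ `h19` under `(B) → EndpointExistence → ForSmallCouplings D (∀ os, …)` (v4 (a)), the law `hζm` ((H-U), `0 ≤ ζ` supplied),
the selector pin `hsel` per tuple (⇒ N27x, UC §0) ⇒ `Spine` at `IsRecordOfRecord₁₃CCoPHOn F N Rg`.  Every displayed antecedent a HYPOTHESIS (0∕1 today). [bookkeeping] -/
theorem spine_rec13CCoPHOn_at_crOfRecord₁₃VAt_cut_of_keyedFacesP_fsc
    (hsel : ∀ (F : T4Family) (θ : Stage13HParams F N), θ.Provisos₁₃CoPH F N → Rg F θ → θ.Admissible F N →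
      ∃ E : B12.RunParams → ℝ, θ.ppSel = ppSelLiveOfRecord F N θ.ν θ.τ9 E (wOfRecord₉ F N θ.toStage9Params))
    (hζm : ∀ (F : T4Family) (θ : Stage13HParams F N), θ.Provisos₁₃CoPH F N → Rg F θ → θ.Admissible F N → ZetaMeasurable F N θ.ζ)
    (h20 : ∀ (F : T4Family) (θ : Stage13HParams F N) (hP : θ.Provisos₁₃CoPH F N), Rg F θ → θ.Admissible F N → ∀ (g₀ : ℕ → ℝ) (os : List (ULoop F)),
      ∃ W : ℕ → ℝ, RelWeightBound 1 (classSet₁₃ θ K₀ g₀) (weightA₁₃ θ hP K₀ g₀ os) (weightB₁₃ θ hP K₀ g₀ os) (badClass₁₃ θ K₀ g₀ (jc F θ hP g₀ os)) W)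
    (h21 : ∀ (F : T4Family) (θ : Stage13HParams F N) (hP : θ.Provisos₁₃CoPH F N), Rg F θ → θ.Admissible F N → ∀ (g₀ : ℕ → ℝ) (os : List (ULoop F)),
      ∃ Wsh : ℕ → ℝ, ShellWeightBound 1 (classSet₁₃ θ K₀ g₀) (weightA₁₃ θ hP K₀ g₀ os) (weightB₁₃ θ hP K₀ g₀ os) (sh F θ hP g₀ os).1 (sh F θ hP g₀ os).2 Wsh)
    (hrates : ∀ (F : T4Family) (θ : Stage13HParams F N) (hP : θ.Provisos₁₃CoPH F N), Rg F θ → θ.Admissible F N →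
      B16.EndStatementBPrinted (datumOfRecord₁₃CoPH F N θ hP).C → DagBinding.EndpointExistence (datumOfRecord₁₃CoPH F N θ hP).C.toB12 →
        ForSmallCouplings (datumOfRecord₁₃CoPH F N θ hP) fun g₀ => ∀ os : List (ULoop F), P (datumOfRecord₁₃CoPH F N θ hP) (rr F θ hP g₀ os))
    (h19 : ∀ (F : T4Family) (θ : Stage13HParams F N) (hP : θ.Provisos₁₃CoPH F N), Rg F θ → θ.Admissible F N →
      B16.EndStatementBPrinted (datumOfRecord₁₃CoPH F N θ hP).C → DagBinding.EndpointExistence (datumOfRecord₁₃CoPH F N θ hP).C.toB12 →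
        ForSmallCouplings (datumOfRecord₁₃CoPH F N θ hP) fun g₀ => ∀ os : List (ULoop F),
          P (datumOfRecord₁₃CoPH F N θ hP) (rr F θ hP g₀ os) → letI : DecidableEq (Σ K, SiteSeqKey F (K₀ + K)) := Classical.decEq _
            ∃ δ : ℕ → ℝ, NE7.Core 1 (F.side ^ 4) (classSet₁₃ θ K₀ g₀) (badClass₁₃ θ K₀ g₀ (jc F θ hP g₀ os)) (fun K t x => weightA₁₃ θ hP K₀ g₀ os K t x - (sh F θ hP g₀ os).1 K t x)
              (fun K t x => weightB₁₃ θ hP K₀ g₀ os K t x - (sh F θ hP g₀ os).2 K t x) δ ∧ Summable δ)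
    : Spine (N := N) fun F D w => Node00.IsRecordOfRecord₁₃CCoPHOn F N Rg D w :=
  (spine_rec13CCoPHOn_iff_forall_guarded Rg).mpr <|
    keyedGuarded₁₃CoPH_of_keyedFacesP_fsc (fun F θ hP g₀ os => crOfRecord₁₃VAt K₀ (jc F θ hP g₀ os) sh F θ hP g₀ os) rr (fun θ => Rg _ θ) P
    (fun F θ hP hRg hθ g₀ os => by
      obtain ⟨W, hW⟩ := h20 F θ hP hRg hθ g₀ os
      exact relWeightBound_crOfRecord₁₃VAt K₀ (jc F θ hP g₀ os) sh θ hP g₀ os hW)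
    (fun F θ hP hRg hθ g₀ os => by
      obtain ⟨Wsh, hWsh⟩ := h21 F θ hP hRg hθ g₀ os
      exact shellWeightBound_crOfRecord₁₃VAt K₀ (jc F θ hP g₀ os) sh θ hP g₀ os hWsh)
    hrates
    (fun F θ hP hRg hθ hB hE => (h19 F θ hP hRg hθ hB hE).mono fun g₀ hg os hPr => by
      letI : DecidableEq (Σ K, SiteSeqKey F (K₀ + K)) := Classical.decEq _
      obtain ⟨Wsh, hWsh⟩ := h21 F θ hP hRg hθ g₀ os
      obtain ⟨δ, hδ, hsum⟩ := hg os hPr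
      exact ⟨_, core_crOfRecord₁₃VAt K₀ (jc F θ hP g₀ os) sh θ hP g₀ os (core_nonneg_of_shellWeightBound hWsh) hδ hsum⟩)
    (fun F θ hP hRg hθ _ _ => by
      obtain ⟨E, hE⟩ := hsel F θ hP hRg hθ
      exact keyedExtraction_crOfRecord₁₃VAt_cut K₀ jc sh θ hP E hE (localBgMeasurable F N θ.ν) (hζm F θ hP hRg hθ) (zeta_nonneg_of_provisos₁₃CoPH F θ hP))

/-! ## §2 On the live-selector line of a regime `G` (`hsel` read off the regime) -/

section Live

variable (G : (F : T4Family) → Stage13HParams F N → Prop)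

/-- ★★ **§1 ON THE LIVE LINE OF A REGIME `G`** (`Rg := G ∧ LiveSel` spelled `N`-generically; `hsel := hRg.2`): at `N = 2`, `G :=` the item's guard, `P := PHolderD4 β`, `rr := rrOfRecord 𝔯 ksel`,
`K₀ = 0`, the binders `hrates` ∕ `h19` ARE v4's `KeyedRatesHolderD4 β (rrOfRecord 𝔯 ksel)` ∕ the keyed-witness form of `KeyedCoreEdgeHolderD4 β cr (rrOfRecord 𝔯 ksel)` restricted to the live
line — what a v4 stub prover at the pin meets. [bookkeeping] -/
theorem spine_rec13CCoPHOn_live_at_crOfRecord₁₃VAt_cut_of_keyedFacesP_fsc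
    (hζm : ∀ (F : T4Family) (θ : Stage13HParams F N), θ.Provisos₁₃CoPH F N → (G F θ ∧ θ.ppSel = ppSelLiveOfRecord F N θ.ν θ.τ9 (EOfRecord₁₃ F N θ.toStage13Params) (wOfRecord₉ F N θ.toStage9Params)) → θ.Admissible F N → ZetaMeasurable F N θ.ζ)
    (h20 : ∀ (F : T4Family) (θ : Stage13HParams F N) (hP : θ.Provisos₁₃CoPH F N), (G F θ ∧ θ.ppSel = ppSelLiveOfRecord F N θ.ν θ.τ9 (EOfRecord₁₃ F N θ.toStage13Params) (wOfRecord₉ F N θ.toStage9Params)) → θ.Admissible F N → ∀ (g₀ : ℕ → ℝ) (os : List (ULoop F)),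
      ∃ W : ℕ → ℝ, RelWeightBound 1 (classSet₁₃ θ K₀ g₀) (weightA₁₃ θ hP K₀ g₀ os) (weightB₁₃ θ hP K₀ g₀ os) (badClass₁₃ θ K₀ g₀ (jc F θ hP g₀ os)) W)
    (h21 : ∀ (F : T4Family) (θ : Stage13HParams F N) (hP : θ.Provisos₁₃CoPH F N), (G F θ ∧ θ.ppSel = ppSelLiveOfRecord F N θ.ν θ.τ9 (EOfRecord₁₃ F N θ.toStage13Params) (wOfRecord₉ F N θ.toStage9Params)) → θ.Admissible F N → ∀ (g₀ : ℕ → ℝ) (os : List (ULoop F)),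
      ∃ Wsh : ℕ → ℝ, ShellWeightBound 1 (classSet₁₃ θ K₀ g₀) (weightA₁₃ θ hP K₀ g₀ os) (weightB₁₃ θ hP K₀ g₀ os) (sh F θ hP g₀ os).1 (sh F θ hP g₀ os).2 Wsh)
    (hrates : ∀ (F : T4Family) (θ : Stage13HParams F N) (hP : θ.Provisos₁₃CoPH F N), (G F θ ∧ θ.ppSel = ppSelLiveOfRecord F N θ.ν θ.τ9 (EOfRecord₁₃ F N θ.toStage13Params) (wOfRecord₉ F N θ.toStage9Params)) → θ.Admissible F N →
      B16.EndStatementBPrinted (datumOfRecord₁₃CoPH F N θ hP).C → DagBinding.EndpointExistence (datumOfRecord₁₃CoPH F N θ hP).C.toB12 →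
        ForSmallCouplings (datumOfRecord₁₃CoPH F N θ hP) fun g₀ => ∀ os : List (ULoop F), P (datumOfRecord₁₃CoPH F N θ hP) (rr F θ hP g₀ os))
    (h19 : ∀ (F : T4Family) (θ : Stage13HParams F N) (hP : θ.Provisos₁₃CoPH F N), (G F θ ∧ θ.ppSel = ppSelLiveOfRecord F N θ.ν θ.τ9 (EOfRecord₁₃ F N θ.toStage13Params) (wOfRecord₉ F N θ.toStage9Params)) → θ.Admissible F N →
      B16.EndStatementBPrinted (datumOfRecord₁₃CoPH F N θ hP).C → DagBinding.EndpointExistence (datumOfRecord₁₃CoPH F N θ hP).C.toB12 →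
        ForSmallCouplings (datumOfRecord₁₃CoPH F N θ hP) fun g₀ => ∀ os : List (ULoop F),
          P (datumOfRecord₁₃CoPH F N θ hP) (rr F θ hP g₀ os) → letI : DecidableEq (Σ K, SiteSeqKey F (K₀ + K)) := Classical.decEq _
            ∃ δ : ℕ → ℝ, NE7.Core 1 (F.side ^ 4) (classSet₁₃ θ K₀ g₀) (badClass₁₃ θ K₀ g₀ (jc F θ hP g₀ os)) (fun K t x => weightA₁₃ θ hP K₀ g₀ os K t x - (sh F θ hP g₀ os).1 K t x)
              (fun K t x => weightB₁₃ θ hP K₀ g₀ os K t x - (sh F θ hP g₀ os).2 K t x) δ ∧ Summable δ)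
    : Spine (N := N) fun F D w => Node00.IsRecordOfRecord₁₃CCoPHOn F N
      (fun F θ => G F θ ∧ θ.ppSel = ppSelLiveOfRecord F N θ.ν θ.τ9 (EOfRecord₁₃ F N θ.toStage13Params) (wOfRecord₉ F N θ.toStage9Params)) D w :=
  spine_rec13CCoPHOn_at_crOfRecord₁₃VAt_cut_of_keyedFacesP_fsc K₀ jc sh _ rr P (fun _ _ _ hRg _ => ⟨_, hRg.2⟩) hζm h20 h21 hrates h19

end Live

end Summit.QuantumFields.YangMills.Theorems.BalabanUVNodesN27SpineRecord
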